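/-
Copyright: lit-balaban READER/TYPER seat r18 (gen 14), C2 §§1–4 fold owner.  Statement-level skeleton of a published paper; no proof
claims beyond what the kernel checks below.
-/
import Literature.MathematicalPhysics.QuantumFieldTheory.BalabanImbrieJaffe1984to88.BIJ88W1PrimeCurlLeftFactorTorus

/-!
# `BalabanImbrieJaffe1984to88.BIJ88HkLoc257AllTori` — T. Bałaban, J. Imbrie, A. Jaffe, *Effective action and cluster properties of the
abelian Higgs model*, Commun. Math. Phys. **114** (1988) 257–315 [BalabanImbrieJaffe1988], Sect. 2 p. 260 [PDF 4]: **(2.5) AND (2.7), WITH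
THEIR ∂-MEMBERS, FOR THE CONCRETE LOCALIZED LANDAU MINIMIZER `H_{j,loc} = ζ_jH_j` OF RECORD — OVER ALL TORI, HYPOTHESIS-FREE**: ONE set of
constants `(δ, M, C)` for EVERY torus `T_η` of the series with `P.d = d`, `P.L = L`, every scale `j ≤ m + K`, every weights `w > 0`, `c ≠ 0`
and every pair of radii `R₁ < R₀` — the printed *"c … independent of k, T_η"* of the one input [6I] Proposition 1.2, in the all-tori shape of
the cell's typing note G-C1-07 that rows C2.Eq2.5 / C2.Eq2.7 still lacked (their torus members were «modulo the typed row C1.Eq7.2.1-7.2.2»).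

statement-level skeleton of published theorems with citation tags; proofs where landed; nothing here is a claim about the Yang–Mills mass gap

PDF held: `paper:balaban1988-cmp114-bij-abelian-higgs-effective-action` (journal page = PDF page + 256), p. 260 [PDF 4] (x2 render
`renders/original-p004-x2.png` of the gen-13 session read as an image; text layer `p0004.txt`); [I] = [BalabanImbrieJaffe1985] (7.2.2) p. 325;
[6I] = [Balaban1984PropagatorsI] Prop. 1.2 p. 35.

CITATION HEADER (lean-in-tree rule).  Part of the lit-balaban TYPED SKELETON (HOME `run/shared/lean/pub/lit-balaban/`), READER/TYPER seat
r18 = the C2 §§1–4 fold owner (`HOME/lit-balaban-r18/ROWS-C2.md`), gen 14, unit `lit-balaban-r18`; free-target protocol G.5-34(d), TAKING line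
HOME/STATUS.md 2026-08-22T03:50Z.  WHAT IS REPRODUCED = SKELETON rows **C2.Eq2.5** and **C2.Eq2.7** (owner r18, referee ref-5; heads `proved`
as hence-steps from (I.7.2.2), p02 g3 `BIJ88Close218Proof.decay_loc` / r18 `BIJ88Sect2Statements.loc_close`), kind «model instance for the objects
of record, hypothesis-free all-tori shape» — the companion, for (2.5)–(2.7), of p08's `BIJ88Sect2DkLocCkAllToriHolds` ((2.13), (2.23), (2.25),
(2.26)), r18's `BIJ88Decay216AllTori` ((2.16)–(2.19)) and `BIJ88Normalization46Torus` §11 ((4.6)), p16's `BIJ85Sect72AllToriHolds` ((7.2.2),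
(7.2.4)).  Decls used BY NAME (nothing restated, nothing re-proved): r18's torus objects `BIJ88CurlyDkLocTorus.hKer` ((7.2.1) kernel of p11's
Landau minimizer `HkE`) and `hlKer` ((2.4) with p13's constructed cutoff (2.1) `BIJ88Cutoffs21.cutoff R₁ R₀` of the block distance `hdist =
distEU`); the per-torus estimates with displayed (I.7.2.2) members — p08 g8/g9 `BIJ88CurlyDkLocDecayTorus.abs_hlKer_le_of_sup` ((2.5) value),
`BIJ88CurlyDkLocGradTerm.abs_hlKer_shift_sub_le` ((2.5) η-gradient: product rule) and `exists_cutoffProfile_lipschitz` (a slope constant of the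
profile, uniform in the radii), `BIJ88OpCloseDkLocGradTorus.abs_hKer_shift_sub_le` / `abs_grad_hKer_sub_hlKer_le` ((7.2.2) gradient member for
`hKer`; η-gradient of (2.7)), p08 g10 `BIJ88W1PrimeCurlLeftFactorTorus.abs_curl_hlKer_le` / `abs_diverg_hlKer_le` / `abs_curl_hKer_sub_hlKer_le` /
`abs_diverg_hKer_sub_hlKer_le` (output curl / divergence forms), r18 g10/g11 `BIJ88CurlyDkLocCloseTorus.abs_hKer_sub_hlKer_le` ((2.7) value),
`BIJ88Ineq217Ineq722Torus.ofLp_HkE_single` (`hKer` IS p09's `(torusRep …).H`); the all-tori input — p08 g9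
`BIJ88Decay223CkAllTori.exists_HB_allTori_of_prop12Printed` (ONE `(δ, M)` for the sup and gradient members of (I.7.2.2) on every torus and
scale, from p16 g7 `BIJ85Sect72AllTori`) with [6I] Prop. 1.2 over the all-tori index DISCHARGED by p19 g6 `BIJ85Prop12AllTori.prop12Printed_allTori`
(p37/p38's theorem `B5Prop12GHolds.prop12_famG_printed`).

THE PRINTED TEXT (p. 260 [PDF 4], verbatim): *"Then the localized version of H_k has a kernel H_{k,loc}(b,b′) = ζ_k(b,b′)H_k(b,b′). (2.4) Since ζ_k
and H_k have good decay properties, so does H_{k,loc} [see (I.7.2.2)]. Thus |H_{k,loc}(b,b′)| ≦ ce^{−c dist(b,b′)} (2.5) and the derivative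
and Hölder derivative of order less than 2 also have exponential decay. Of course by construction, H_{k,loc}(b,b′) = 0, if dist(b,b′) ≧
⅛r(e_k). (2.6) Furthermore, H_{k,loc} − H_k is small: |H_{k,loc}(b,b′) − H_k(b,b′)| ≦ e^{−cr(e_k)}e^{−c dist(b,b′)}. (2.7) and similarly for
∂H_{k,loc}, ∂*H_{k,loc}, …"*; p. 259: *"We let c denote constants that may change from line to line; they are independent of k, ε, e_k"*; [6I]
p. 35: constants *"independent of k, T_η"*.

THE READING (as in the cited per-torus files; nothing new).  `H_j(b, b₁) = hKer w c j b b₁` (`b` an `η`-bond of `T_η = Site P 0`, `b₁` a bond of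
`T₁^{(j)} = Site P j`), `H_{j,loc}(b, b₁) = hlKer w c R₁ R₀ j b b₁ = ζ_j(b,b₁)H_j(b,b₁)` with `ζ_j = cutoff R₁ R₀ hdist`, `dist(b, b₁) = dist_j(b, b₁)
= distEU P j b.src b₁.src` (sup-distance to the block centre in units of `T₁^{(j)}`; `hdist j b b₁` is this by definition); the print's radii are
`R₁ = r(e_j)/16`, `R₀ = r(e_j)/8` — here ANY `R₁ < R₀` (the value member of (2.5) for any radii at all); `η`-gradient `Δ_λF(⟨x, μ⟩) = F(⟨x + e_λ,
μ⟩) − F(⟨x, μ⟩)` carries the printed gain `(L^j)^{−1}` (one `η`-step is `L^{−j}` in units of `T₁^{(j)}`); output curl `∂^η = curl (L^k)`,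
output divergence `∂^{η*} = diverg (L^k)` of the column `b ↦ H(b, b₁)` at any step `k`.  The kernel `hKer w c j` does not depend on the mass
parameter `a` of the representation `torusRep P j (deltaAData hj a)`; the proofs fix `a = 1`.

WHAT IS PROVED (0 `sorry`, standard axioms; theorems only — proof lane; every proof is a composition BY NAME of the cited lemmas with the two
all-tori inputs; hypotheses remaining: NONE beyond `1 ≤ d`, `L` odd `> 1` — the standing `Params` constraints):
* §1 (2.5) — **`eq25_hKer_allTori`** (ONE `(δ, M)`: `|H_j(b,b₁)| ≤ Me^{−δ dist_j(b,b₁)}` and `|Δ_λH_j(⟨x,μ⟩,b₁)| ≤ (L^j)^{−1}Me^{−δ dist_j(x,b₁)}`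
  on every torus, every `j ≤ m + K`, every `w > 0`, `c ≠ 0`), **`eq25_hlKer_allTori`** (the same `(δ, M)` and ONE `C ≥ 0`: `|H_{j,loc}(b,b₁)| ≤
  Me^{−δ dist_j}` for ANY radii, and `|Δ_λH_{j,loc}(⟨x,μ⟩,b₁)| ≤ (L^j)^{−1}M(1 + C/(R₀−R₁))e^{−δ dist_j(x,b₁)}` for every `R₁ < R₀`);
* §2 (2.7) — **`eq27_hlKer_allTori`** (value: `|H_j(b,b₁) − H_{j,loc}(b,b₁)| ≤ Me^{−(δ/2)R₁}e^{−(δ/2)dist_j}`; η-gradient: `|Δ_λ(H_j − H_{j,loc})| ≤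
  (L^j)^{−1}M(1 + C/(R₀−R₁))e^{δ/2}e^{−(δ/2)R₁}·e^{−(δ/2)dist_j}`, every `R₁ < R₀`), **`eq27_hlKer_allTori_sched`** (AT THE PRINTED INNER RADIUS
  `R₁ = ρ_j/16`, `R₀ = ρ_j/8` of any radius schedule with `ρ_j > 0`, e.g. r18's `rSched`: smallness literally `Me^{−(δ/32)ρ_j}` = print's
  `e^{−cr(e_j)}`);
* §3 the p. 260 tail sentence *"similarly for ∂H_{k,loc}, ∂*H_{k,loc}"* in OUTPUT form over all tori — **`curlDiv_hlKer_allTori`** (`|(∂^ηH_{j,loc}(·,b₁))(p)|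
  ≤ 2L^k(L^j)^{−1}M(1 + C/(R₀−R₁))e^{−δ dist_j(p,b₁)}`, `|(∂^{η*}H_{j,loc}(·,b₁))(x)| ≤ d·L^k(L^j)^{−1}M(1 + C/(R₀−R₁))e^{δ}e^{−δ dist_j(x,b₁)}`, and
  the two `H_j` columns) and **`curlDiv_hKer_sub_hlKer_allTori`** (the ∂/∂*-form of (2.7): the same with the extra `e^{δ/2}e^{−(δ/2)R₁}` at rate `δ/2`);
* §4 per-torus hypothesis-free corollaries **`eq25_27_hlKer_torus`** (every `P : Params`: its own `d`, `L` — constants as functions of the torus'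
  `(d, L)` only, i.e. the all-tori constants specialised).
HONEST SCOPE.  (i) Pure discharge/composition: the analysis is in the cited per-torus files (explicit constants there) and in the all-tori input
files; the constants here are existential (chosen before the torus, the scale, the weights and the radii).  (ii) (2.6) is structural for the
object of record (`BIJ88CurlyDkLocTorus.hlKer_eq_zero_of_le`: `H_{j,loc}(b,b₁) = 0` once `dist_j(b,b₁) ≥ R₀`, any torus) and is not repeated.
(iii) The Hölder member («Hölder derivative of order less than 2») is NOT here: for the sup-norm block distance of record the cutoff `ζ_j` is only
Lipschitz in `b`, and no k-uniform Hölder bound of order `1 + θ` holds for THAT object (owner note, `HOME/lit-balaban-r18/C2S14-CLOSURE.md` §3.5).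
(iv) `U = 1`, real abelian fields, torus, standing range `j ≤ m + K`; `1 ≤ d`, `L` odd `> 1` are fields of `Params`.  (v) No `def`, no new named
fact, nothing restated; NOT summit progress.  Unit `lit-balaban-r18` (literature-prover-lit-balaban-r18-g14-0), 2026-08-22.
-/

open scoped BigOperators RealInnerProductSpace

namespace Literature.MathematicalPhysics.QuantumFieldTheory.BalabanImbrieJaffe1984to88.BIJ88HkLoc257AllTori

open Balaban1983to89 hiding Site Plaq
open Balaban1983to89.LatticeFieldCalculus
open BIJ88Ineq217Ineq722Torus (ofLp_HkE_single)
open BIJ85Prop521Torus BIJ85Prop522Torus BIJ85Sigma422Eta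
open BIJ85Sect7Statements BIJ85Ineq722Torus
open BIJ85Ineq722DeltaA (deltaAData)
open BIJ85Ineq722ProofPart2 (settingOf)
open BIJ88Cutoffs21 (cutoff cutoffProfile)
open BIJ85Prop12AllTori (prop12Printed_allTori)
open BIJ88Decay223CkAllTori (exists_HB_allTori_of_prop12Printed)
open BIJ88CurlyDkLocTorus
open BIJ88CurlyDkLocDecayTorus (abs_hlKer_le_of_sup)
open BIJ88CurlyDkLocGradTerm (abs_hlKer_shift_sub_le exists_cutoffProfile_lipschitz)
open BIJ88OpCloseDkLocGradTorus (abs_hKer_shift_sub_le abs_grad_hKer_sub_hlKer_le)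
open BIJ88CurlyDkLocCloseTorus (abs_hKer_sub_hlKer_le)
open BIJ88W1PrimeCurlLeftFactorTorus (abs_curl_hKer_le abs_curl_hlKer_le abs_curl_hKer_sub_hlKer_le abs_diverg_hKer_le
  abs_diverg_hlKer_le abs_diverg_hKer_sub_hlKer_le)
-- inside this namespace the bare `Site`/`Plaq` are the `ℤ^d` carriers of the QFT root; the torus ones are renamed:
open Balaban1983to89 renaming Site → TSite, Plaq → TPlaq

noncomputable section

/-! ## §0  The two all-tori inputs, packaged: ONE `(δ, M)` for the sup and gradient members of (I.7.2.2), ONE slope constant `C` -/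

/-- **THE ALL-TORI INPUT**: ONE `(δ, M)`, `δ > 0`, `M ≥ 1`, bounding the sup member and the `η`-gradient member of (I.7.2.2) for the Landau kernel
of EVERY torus (`P.d = d`, `P.L = L`) at EVERY scale `j ≤ m + K` (representation `torusRep P j (deltaAData hj 1)`), from [6I] Prop. 1.2 over the
all-tori index (p19's `prop12Printed_allTori`) through p08's `exists_HB_allTori_of_prop12Printed`; and ONE slope constant `C ≥ 0` of p13's cutoff
profile, `|σ_{R₁,R₀}(t) − σ_{R₁,R₀}(s)| ≤ (C/(R₀ − R₁))|t − s|` for all radii `R₁ < R₀` (p08's `exists_cutoffProfile_lipschitz`).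
[cite: BalabanImbrieJaffe1985, (7.2.2) p.325] -/
theorem exists_HBC_allTori {d L : ℕ} (hd : 1 ≤ d) (hL : Odd L ∧ 1 < L) :
    ∃ δ M C : ℝ, 0 < δ ∧ 1 ≤ M ∧ 0 ≤ C ∧
      (∀ (P : Params) (_ : P.d = d) (_ : P.L = L) (j : ℕ) (hj : j ≤ P.m + P.K) (μ ν : Fin P.d) (x : TSite P 0) (y : TSite P j),
        |(torusRep P j (deltaAData hj 1)).H (x, μ) (y, ν)| ≤ M * Real.exp (-(δ * distEU P j x y)) ∧
        ‖fun lam : Fin P.d => (P.L : ℝ) ^ j *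
            ((torusRep P j (deltaAData hj 1)).H (x.shift lam, μ) (y, ν) - (torusRep P j (deltaAData hj 1)).H (x, μ) (y, ν))‖ ≤
          M * Real.exp (-(δ * distEU P j x y))) ∧
      (∀ (R₁ R₀ : ℝ), R₁ < R₀ → ∀ t s : ℝ, |cutoffProfile R₁ R₀ t - cutoffProfile R₁ R₀ s| ≤ C / (R₀ - R₁) * |t - s|) := by
  obtain ⟨δ, M, hδ, hM, hHB⟩ :=
    exists_HB_allTori_of_prop12Printed hd hL (zero_lt_one : (0 : ℝ) < 1) (prop12Printed_allTori d L zero_lt_one)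
  obtain ⟨C, hC0, hC⟩ := exists_cutoffProfile_lipschitz
  exact ⟨δ, M, C, hδ, hM, hC0, hHB, hC⟩

/-! ## §1  (2.5) for `H_j` and `H_{j,loc}` over all tori, hypothesis-free -/

/-- **THE LANDAU KERNEL `H_j` OF RECORD, VALUE AND `η`-GRADIENT, WITH ONE `(δ, M)` ON EVERY TORUS** (`1 ≤ d`, `L` odd `> 1`): for every torus
(`P.d = d`, `P.L = L`), every `j ≤ m + K`, every `w > 0`, `c ≠ 0`: `|H_j(b, b₁)| ≤ Me^{−δ dist_j(b,b₁)}` and `|H_j(⟨x+e_λ, μ⟩, b₁) − H_j(⟨x, μ⟩, b₁)| ≤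
(L^j)^{−1}Me^{−δ dist_j(x,b₁)}` — the sup and gradient members of (I.7.2.2) *"see (I.7.2.2)"* for r18's `hKer`, constants *"independent of k, T_η"*.
[cite: BalabanImbrieJaffe1988, (2.5) p.260] -/
theorem eq25_hKer_allTori {d L : ℕ} (hd : 1 ≤ d) (hL : Odd L ∧ 1 < L) :
    ∃ δ M : ℝ, 0 < δ ∧ 1 ≤ M ∧ ∀ (P : Params) (_ : P.d = d) (_ : P.L = L) (j : ℕ) (_ : j ≤ P.m + P.K) (w : ℝ) (_ : 0 < w)
      (c : ℝ) (_ : c ≠ 0),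
      (∀ (b : PBond P 0) (b₁ : PBond P j), |hKer (P := P) w c j b b₁| ≤ M * Real.exp (-(δ * distEU P j b.src b₁.src))) ∧
      (∀ (x : TSite P 0) (μ lam : Fin P.d) (b₁ : PBond P j),
        |hKer (P := P) w c j ⟨x.shift lam, μ⟩ b₁ - hKer (P := P) w c j ⟨x, μ⟩ b₁| ≤
          ((P.L : ℝ) ^ j)⁻¹ * M * Real.exp (-(δ * distEU P j x b₁.src))) := by
  obtain ⟨δ, M, C, hδ, hM, _, hHB, _⟩ := exists_HBC_allTori hd hL
  refine ⟨δ, M, hδ, hM, fun P hPd hPL j hj w hw c hc => ⟨fun b b₁ => ?_, fun x μ lam b₁ => ?_⟩⟩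
  · have e : hKer (P := P) w c j b b₁ = (torusRep P j (deltaAData hj 1)).H (b.src, b.dir) (b₁.src, b₁.dir) :=
      ofLp_HkE_single hj hc hw zero_lt_one b₁ b.src b.dir
    rw [e]
    exact (hHB P hPd hPL j hj b.dir b₁.dir b.src b₁.src).1
  · exact abs_hKer_shift_sub_le hj hw hc zero_lt_one (fun μ ν x y => (hHB P hPd hPL j hj μ ν x y).2) x μ lam b₁

/-- **(2.5) FOR THE CONCRETE `H_{j,loc} = ζ_jH_j`, VALUE AND `η`-GRADIENT, OVER ALL TORI, HYPOTHESIS-FREE** (`1 ≤ d`, `L` odd `> 1`): ONE `(δ, M, C)`,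
`δ > 0`, `M ≥ 1`, `C ≥ 0`, such that for every torus (`P.d = d`, `P.L = L`), every `j ≤ m + K`, every `w > 0`, `c ≠ 0`: for ANY radii `R₁, R₀`,
`|H_{j,loc}(b, b₁)| ≤ Me^{−δ dist_j(b,b₁)}` *"Thus |H_{k,loc}(b,b′)| ≦ ce^{−c dist(b,b′)} (2.5)"*; and for every `R₁ < R₀` *"the derivative … also
[has] exponential decay"*: `|H_{j,loc}(⟨x+e_λ, μ⟩, b₁) − H_{j,loc}(⟨x, μ⟩, b₁)| ≤ (L^j)^{−1}M(1 + C/(R₀ − R₁))e^{−δ dist_j(x,b₁)}` (product rule; at the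
printed radii `R₀ − R₁ = r(e_j)/16`). [cite: BalabanImbrieJaffe1988, (2.5) p.260] -/
theorem eq25_hlKer_allTori {d L : ℕ} (hd : 1 ≤ d) (hL : Odd L ∧ 1 < L) :
    ∃ δ M C : ℝ, 0 < δ ∧ 1 ≤ M ∧ 0 ≤ C ∧ ∀ (P : Params) (_ : P.d = d) (_ : P.L = L) (j : ℕ) (_ : j ≤ P.m + P.K) (w : ℝ) (_ : 0 < w)
      (c : ℝ) (_ : c ≠ 0),
      (∀ (R₁ R₀ : ℝ) (b : PBond P 0) (b₁ : PBond P j),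
        |hlKer (P := P) w c R₁ R₀ j b b₁| ≤ M * Real.exp (-(δ * distEU P j b.src b₁.src))) ∧
      (∀ (R₁ R₀ : ℝ), R₁ < R₀ → ∀ (x : TSite P 0) (μ lam : Fin P.d) (b₁ : PBond P j),
        |hlKer (P := P) w c R₁ R₀ j ⟨x.shift lam, μ⟩ b₁ - hlKer (P := P) w c R₁ R₀ j ⟨x, μ⟩ b₁| ≤
          ((P.L : ℝ) ^ j)⁻¹ * (M * (1 + C / (R₀ - R₁))) * Real.exp (-(δ * distEU P j x b₁.src))) := by
  obtain ⟨δ, M, C, hδ, hM, hC0, hHB, hC⟩ := exists_HBC_allTori hd hL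
  refine ⟨δ, M, C, hδ, hM, hC0, fun P hPd hPL j hj w hw c hc => ⟨fun R₁ R₀ b b₁ => ?_, fun R₁ R₀ hR x μ lam b₁ => ?_⟩⟩
  · exact abs_hlKer_le_of_sup hj hw hc zero_lt_one (fun μ ν x y => (hHB P hPd hPL j hj μ ν x y).1) R₁ R₀ b b₁
  · exact abs_hlKer_shift_sub_le hj hw hc zero_lt_one (fun μ ν x y => (hHB P hPd hPL j hj μ ν x y).1)
      (fun μ ν x y => (hHB P hPd hPL j hj μ ν x y).2) hC0 hR (hC R₁ R₀ hR) x μ lam b₁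

/-! ## §2  (2.7) for `H_{j,loc}` over all tori, hypothesis-free -/

/-- **(2.7) FOR THE CONCRETE `H_{j,loc}`, VALUE AND `η`-GRADIENT, OVER ALL TORI, HYPOTHESIS-FREE** (`1 ≤ d`, `L` odd `> 1`): ONE `(δ, M, C)` such that
for every torus (`P.d = d`, `P.L = L`), every `j ≤ m + K`, every `w > 0`, `c ≠ 0` and every radii `R₁ < R₀`: *"H_{k,loc} − H_k is small:
|H_{k,loc}(b,b′) − H_k(b,b′)| ≦ e^{−cr(e_k)}e^{−c dist(b,b′)} (2.7)"* as `|H_j(b,b₁) − H_{j,loc}(b,b₁)| ≤ Me^{−(δ/2)R₁}·e^{−(δ/2)dist_j(b,b₁)}` (the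
difference `(1 − ζ_j)H_j` vanishes within `R₁`; print `R₁ = r(e_k)/16`), and its `η`-gradient *"similarly for ∂H_{k,loc}"*:
`|Δ_λ(H_j − H_{j,loc})(⟨x,μ⟩, b₁)| ≤ (L^j)^{−1}M(1 + C/(R₀ − R₁))e^{δ/2}e^{−(δ/2)R₁}·e^{−(δ/2)dist_j(x,b₁)}`. [cite: BalabanImbrieJaffe1988, (2.7) p.260] -/
theorem eq27_hlKer_allTori {d L : ℕ} (hd : 1 ≤ d) (hL : Odd L ∧ 1 < L) :
    ∃ δ M C : ℝ, 0 < δ ∧ 1 ≤ M ∧ 0 ≤ C ∧ ∀ (P : Params) (_ : P.d = d) (_ : P.L = L) (j : ℕ) (_ : j ≤ P.m + P.K) (w : ℝ) (_ : 0 < w)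
      (c : ℝ) (_ : c ≠ 0) (R₁ R₀ : ℝ), R₁ < R₀ →
      (∀ (b : PBond P 0) (b₁ : PBond P j),
        |hKer (P := P) w c j b b₁ - hlKer (P := P) w c R₁ R₀ j b b₁| ≤
          M * Real.exp (-(δ / 2 * R₁)) * Real.exp (-(δ / 2 * distEU P j b.src b₁.src))) ∧
      (∀ (x : TSite P 0) (μ lam : Fin P.d) (b₁ : PBond P j),
        |(hKer (P := P) w c j ⟨x.shift lam, μ⟩ b₁ - hlKer (P := P) w c R₁ R₀ j ⟨x.shift lam, μ⟩ b₁) -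
            (hKer (P := P) w c j ⟨x, μ⟩ b₁ - hlKer (P := P) w c R₁ R₀ j ⟨x, μ⟩ b₁)| ≤
          (((P.L : ℝ) ^ j)⁻¹ * (M * (1 + C / (R₀ - R₁)) * Real.exp (δ / 2) * Real.exp (-(δ / 2 * R₁)))) *
            Real.exp (-(δ / 2 * distEU P j x b₁.src))) := by
  obtain ⟨δ, M, C, hδ, hM, hC0, hHB, hC⟩ := exists_HBC_allTori hd hL
  refine ⟨δ, M, C, hδ, hM, hC0, fun P hPd hPL j hj w hw c hc R₁ R₀ hR => ⟨fun b b₁ => ?_, fun x μ lam b₁ => ?_⟩⟩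
  · exact abs_hKer_sub_hlKer_le hj hw hc zero_lt_one hδ.le (fun μ ν x y => (hHB P hPd hPL j hj μ ν x y).1) hR b b₁
  · exact abs_grad_hKer_sub_hlKer_le hj hw hc zero_lt_one hδ.le (fun μ ν x y => (hHB P hPd hPL j hj μ ν x y).1)
      (fun μ ν x y => (hHB P hPd hPL j hj μ ν x y).2) hC0 hR (hC R₁ R₀ hR) x μ lam b₁

/-- **(2.7) AT THE PRINTED RADII OF A RADIUS SCHEDULE, OVER ALL TORI**: with `R₁ = ρ_j/16`, `R₀ = ρ_j/8` (print: `ρ_j = r(e_j) = |log e_j⁻¹|^r`, (2.1)–(2.3);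
here ANY schedule `ρ` with `ρ_j > 0`, e.g. r18's `rSched L ε e r d`), ONE `(δ, M)` such that for every torus (`P.d = d`, `P.L = L`), every `j ≤ m + K`,
every `w > 0`, `c ≠ 0`: `|H_j(b,b₁) − H_{j,loc}[ρ](b,b₁)| ≤ M·e^{−(δ/32)ρ_j}·e^{−(δ/2)dist_j(b,b₁)}` — the printed smallness factor `e^{−cr(e_j)}`
literally. [cite: BalabanImbrieJaffe1988, (2.7) p.260] -/
theorem eq27_hlKer_allTori_sched {d L : ℕ} (hd : 1 ≤ d) (hL : Odd L ∧ 1 < L) :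
    ∃ δ M : ℝ, 0 < δ ∧ 1 ≤ M ∧ ∀ (P : Params) (_ : P.d = d) (_ : P.L = L) (j : ℕ) (_ : j ≤ P.m + P.K) (w : ℝ) (_ : 0 < w)
      (c : ℝ) (_ : c ≠ 0) (ρ : ℕ → ℝ), 0 < ρ j → ∀ (b : PBond P 0) (b₁ : PBond P j),
        |hKer (P := P) w c j b b₁ - hlKer (P := P) w c (ρ j / 16) (ρ j / 8) j b b₁| ≤
          M * Real.exp (-(δ / 32 * ρ j)) * Real.exp (-(δ / 2 * distEU P j b.src b₁.src)) := by
  obtain ⟨δ, M, C, hδ, hM, _, h27⟩ := eq27_hlKer_allTori hd hL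
  refine ⟨δ, M, hδ, hM, fun P hPd hPL j hj w hw c hc ρ hρ b b₁ => ?_⟩
  have hR : ρ j / 16 < ρ j / 8 := by linarith
  have h := (h27 P hPd hPL j hj w hw c hc (ρ j / 16) (ρ j / 8) hR).1 b b₁
  have e : δ / 2 * (ρ j / 16) = δ / 32 * ρ j := by ring
  rwa [e] at h

/-! ## §3  *"and similarly for ∂H_{k,loc}, ∂*H_{k,loc}"* in OUTPUT form over all tori, hypothesis-free -/

/-- **THE OUTPUT CURL AND DIVERGENCE OF THE COLUMNS `H_j(·, b₁)`, `H_{j,loc}(·, b₁)` OVER ALL TORI, HYPOTHESIS-FREE** (`1 ≤ d`, `L` odd `> 1`;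
`∂^η = curl (L^k)`, `∂^{η*} = diverg (L^k)` at any step `k`; p08 g10's `BIJ88W1PrimeCurlLeftFactorTorus` with its displayed (I.7.2.2) members and
slope constant DISCHARGED): ONE `(δ, M, C)` such that for every torus (`P.d = d`, `P.L = L`), every `j ≤ m + K`, `w > 0`, `c ≠ 0`, every `k`:
`|(∂^ηH_j(·,b₁))(p)| ≤ 2L^k·(L^j)^{−1}Me^{−δ dist_j(p,b₁)}`, `|(∂^{η*}H_j(·,b₁))(x)| ≤ d·L^k·(L^j)^{−1}M·e^{δ}e^{−δ dist_j(x,b₁)}`, and, for every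
`R₁ < R₀`, `|(∂^ηH_{j,loc}(·,b₁))(p)| ≤ 2L^k·(L^j)^{−1}M(1 + C/(R₀−R₁))e^{−δ dist_j(p,b₁)}`, `|(∂^{η*}H_{j,loc}(·,b₁))(x)| ≤
d·L^k·(L^j)^{−1}M(1 + C/(R₀−R₁))e^{δ}e^{−δ dist_j(x,b₁)}`. [cite: BalabanImbrieJaffe1988, (2.5) p.260] -/
theorem curlDiv_hlKer_allTori {d L : ℕ} (hd : 1 ≤ d) (hL : Odd L ∧ 1 < L) :
    ∃ δ M C : ℝ, 0 < δ ∧ 1 ≤ M ∧ 0 ≤ C ∧ ∀ (P : Params) (_ : P.d = d) (_ : P.L = L) (j : ℕ) (_ : j ≤ P.m + P.K) (w : ℝ) (_ : 0 < w)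
      (c : ℝ) (_ : c ≠ 0) (k : ℕ),
      (∀ (p : TPlaq P 0) (b₁ : PBond P j),
        |curl ((P.L : ℝ) ^ k) (fun b : PBond P 0 => hKer (P := P) w c j b b₁) p| ≤
          2 * (P.L : ℝ) ^ k * (((P.L : ℝ) ^ j)⁻¹ * M * Real.exp (-(δ * distEU P j p.src b₁.src)))) ∧
      (∀ (x : TSite P 0) (b₁ : PBond P j),
        |diverg ((P.L : ℝ) ^ k) (fun b : PBond P 0 => hKer (P := P) w c j b b₁) x| ≤
          P.d * (P.L : ℝ) ^ k * (((P.L : ℝ) ^ j)⁻¹ * M * (Real.exp δ * Real.exp (-(δ * distEU P j x b₁.src))))) ∧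
      (∀ (R₁ R₀ : ℝ), R₁ < R₀ → ∀ (p : TPlaq P 0) (b₁ : PBond P j),
        |curl ((P.L : ℝ) ^ k) (fun b : PBond P 0 => hlKer (P := P) w c R₁ R₀ j b b₁) p| ≤
          2 * (P.L : ℝ) ^ k * (((P.L : ℝ) ^ j)⁻¹ * (M * (1 + C / (R₀ - R₁))) * Real.exp (-(δ * distEU P j p.src b₁.src)))) ∧
      (∀ (R₁ R₀ : ℝ), R₁ < R₀ → ∀ (x : TSite P 0) (b₁ : PBond P j),
        |diverg ((P.L : ℝ) ^ k) (fun b : PBond P 0 => hlKer (P := P) w c R₁ R₀ j b b₁) x| ≤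
          P.d * (P.L : ℝ) ^ k * (((P.L : ℝ) ^ j)⁻¹ * (M * (1 + C / (R₀ - R₁))) *
            (Real.exp δ * Real.exp (-(δ * distEU P j x b₁.src))))) := by
  obtain ⟨δ, M, C, hδ, hM, hC0, hHB, hC⟩ := exists_HBC_allTori hd hL
  refine ⟨δ, M, C, hδ, hM, hC0, fun P hPd hPL j hj w hw c hc k => ⟨fun p b₁ => ?_, fun x b₁ => ?_, fun R₁ R₀ hR p b₁ => ?_,
    fun R₁ R₀ hR x b₁ => ?_⟩⟩
  · exact abs_curl_hKer_le hj hw hc zero_lt_one (fun μ ν x y => (hHB P hPd hPL j hj μ ν x y).2) k p b₁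
  · exact abs_diverg_hKer_le hj hw hc zero_lt_one hδ.le (fun μ ν x y => (hHB P hPd hPL j hj μ ν x y).2) k x b₁
  · exact abs_curl_hlKer_le hj hw hc zero_lt_one (fun μ ν x y => (hHB P hPd hPL j hj μ ν x y).1)
      (fun μ ν x y => (hHB P hPd hPL j hj μ ν x y).2) hC0 hR (hC R₁ R₀ hR) k p b₁
  · exact abs_diverg_hlKer_le hj hw hc zero_lt_one hδ.le (fun μ ν x y => (hHB P hPd hPL j hj μ ν x y).1)
      (fun μ ν x y => (hHB P hPd hPL j hj μ ν x y).2) hC0 hR (hC R₁ R₀ hR) k x b₁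

/-- **THE ∂/∂*-FORM OF (2.7) OVER ALL TORI, HYPOTHESIS-FREE** (`1 ≤ d`, `L` odd `> 1`): ONE `(δ, M, C)` such that for every torus (`P.d = d`,
`P.L = L`), every `j ≤ m + K`, `w > 0`, `c ≠ 0`, every `k` and every radii `R₁ < R₀`, the differenced column `(H_j − H_{j,loc})(·, b₁)` has output curl
`|(∂^η(H_j − H_{j,loc})(·,b₁))(p)| ≤ 2L^k·[(L^j)^{−1}M(1 + C/(R₀−R₁))e^{δ/2}e^{−(δ/2)R₁}]·e^{−(δ/2)dist_j(p,b₁)}` and output divergence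
`|(∂^{η*}(H_j − H_{j,loc})(·,b₁))(x)| ≤ d·L^k·[…]·e^{δ/2}e^{−(δ/2)dist_j(x,b₁)}` — *"similarly for ∂H_{k,loc}, ∂*H_{k,loc}"* applied to (2.7), the
smallness `e^{−(δ/2)R₁}` being `e^{−cr(e_j)}` at the printed `R₁ = r(e_j)/16`. [cite: BalabanImbrieJaffe1988, (2.7) p.260] -/
theorem curlDiv_hKer_sub_hlKer_allTori {d L : ℕ} (hd : 1 ≤ d) (hL : Odd L ∧ 1 < L) :
    ∃ δ M C : ℝ, 0 < δ ∧ 1 ≤ M ∧ 0 ≤ C ∧ ∀ (P : Params) (_ : P.d = d) (_ : P.L = L) (j : ℕ) (_ : j ≤ P.m + P.K) (w : ℝ) (_ : 0 < w)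
      (c : ℝ) (_ : c ≠ 0) (k : ℕ) (R₁ R₀ : ℝ), R₁ < R₀ →
      (∀ (p : TPlaq P 0) (b₁ : PBond P j),
        |curl ((P.L : ℝ) ^ k) (fun b : PBond P 0 => hKer (P := P) w c j b b₁ - hlKer (P := P) w c R₁ R₀ j b b₁) p| ≤
          2 * (P.L : ℝ) ^ k * ((((P.L : ℝ) ^ j)⁻¹ * (M * (1 + C / (R₀ - R₁)) * Real.exp (δ / 2) * Real.exp (-(δ / 2 * R₁)))) *
            Real.exp (-(δ / 2 * distEU P j p.src b₁.src)))) ∧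
      (∀ (x : TSite P 0) (b₁ : PBond P j),
        |diverg ((P.L : ℝ) ^ k) (fun b : PBond P 0 => hKer (P := P) w c j b b₁ - hlKer (P := P) w c R₁ R₀ j b b₁) x| ≤
          P.d * (P.L : ℝ) ^ k * ((((P.L : ℝ) ^ j)⁻¹ * (M * (1 + C / (R₀ - R₁)) * Real.exp (δ / 2) * Real.exp (-(δ / 2 * R₁)))) *
            (Real.exp (δ / 2) * Real.exp (-(δ / 2 * distEU P j x b₁.src))))) := by
  obtain ⟨δ, M, C, hδ, hM, hC0, hHB, hC⟩ := exists_HBC_allTori hd hL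
  refine ⟨δ, M, C, hδ, hM, hC0, fun P hPd hPL j hj w hw c hc k R₁ R₀ hR => ⟨fun p b₁ => ?_, fun x b₁ => ?_⟩⟩
  · exact abs_curl_hKer_sub_hlKer_le hj hw hc zero_lt_one hδ.le (fun μ ν x y => (hHB P hPd hPL j hj μ ν x y).1)
      (fun μ ν x y => (hHB P hPd hPL j hj μ ν x y).2) hC0 hR (hC R₁ R₀ hR) k p b₁
  · exact abs_diverg_hKer_sub_hlKer_le hj hw hc zero_lt_one hδ.le (fun μ ν x y => (hHB P hPd hPL j hj μ ν x y).1)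
      (fun μ ν x y => (hHB P hPd hPL j hj μ ν x y).2) hC0 hR (hC R₁ R₀ hR) k x b₁

/-! ## §4  Per torus, hypothesis-free (the all-tori constants specialised to the torus' own `(d, L)`) -/

/-- **(2.5) AND (2.7) FOR THE CONCRETE `H_{j,loc}` ON ONE TORUS, HYPOTHESIS-FREE**: for every `P : Params` there are `(δ, M, C)` — functions of
`(P.d, P.L)` only — with, for every `j ≤ m + K`, `w > 0`, `c ≠ 0` and radii `R₁ < R₀`: the (2.5) value and `η`-gradient bounds for `H_{j,loc}` and
the (2.7) value and `η`-gradient bounds for `H_j − H_{j,loc}` (the standing `Params` constraints `1 ≤ d`, `L` odd `> 1` feed the all-tori theorems).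
[cite: BalabanImbrieJaffe1988, (2.5)–(2.7) p.260] -/
theorem eq25_27_hlKer_torus (P : Params) :
    ∃ δ M C : ℝ, 0 < δ ∧ 1 ≤ M ∧ 0 ≤ C ∧ ∀ (j : ℕ) (_ : j ≤ P.m + P.K) (w : ℝ) (_ : 0 < w) (c : ℝ) (_ : c ≠ 0) (R₁ R₀ : ℝ),
      R₁ < R₀ →
      (∀ (b : PBond P 0) (b₁ : PBond P j), |hlKer (P := P) w c R₁ R₀ j b b₁| ≤ M * Real.exp (-(δ * distEU P j b.src b₁.src))) ∧
      (∀ (x : TSite P 0) (μ lam : Fin P.d) (b₁ : PBond P j),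
        |hlKer (P := P) w c R₁ R₀ j ⟨x.shift lam, μ⟩ b₁ - hlKer (P := P) w c R₁ R₀ j ⟨x, μ⟩ b₁| ≤
          ((P.L : ℝ) ^ j)⁻¹ * (M * (1 + C / (R₀ - R₁))) * Real.exp (-(δ * distEU P j x b₁.src))) ∧
      (∀ (b : PBond P 0) (b₁ : PBond P j),
        |hKer (P := P) w c j b b₁ - hlKer (P := P) w c R₁ R₀ j b b₁| ≤
          M * Real.exp (-(δ / 2 * R₁)) * Real.exp (-(δ / 2 * distEU P j b.src b₁.src))) ∧
      (∀ (x : TSite P 0) (μ lam : Fin P.d) (b₁ : PBond P j),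
        |(hKer (P := P) w c j ⟨x.shift lam, μ⟩ b₁ - hlKer (P := P) w c R₁ R₀ j ⟨x.shift lam, μ⟩ b₁) -
            (hKer (P := P) w c j ⟨x, μ⟩ b₁ - hlKer (P := P) w c R₁ R₀ j ⟨x, μ⟩ b₁)| ≤
          (((P.L : ℝ) ^ j)⁻¹ * (M * (1 + C / (R₀ - R₁)) * Real.exp (δ / 2) * Real.exp (-(δ / 2 * R₁)))) *
            Real.exp (-(δ / 2 * distEU P j x b₁.src))) := by
  obtain ⟨δ, M, C, hδ, hM, hC0, hHB, hC⟩ := exists_HBC_allTori P.hd P.hL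
  refine ⟨δ, M, C, hδ, hM, hC0, fun j hj w hw c hc R₁ R₀ hR => ⟨fun b b₁ => ?_, fun x μ lam b₁ => ?_, fun b b₁ => ?_,
    fun x μ lam b₁ => ?_⟩⟩
  · exact abs_hlKer_le_of_sup hj hw hc zero_lt_one (fun μ ν x y => (hHB P rfl rfl j hj μ ν x y).1) R₁ R₀ b b₁
  · exact abs_hlKer_shift_sub_le hj hw hc zero_lt_one (fun μ ν x y => (hHB P rfl rfl j hj μ ν x y).1)
      (fun μ ν x y => (hHB P rfl rfl j hj μ ν x y).2) hC0 hR (hC R₁ R₀ hR) x μ lam b₁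
  · exact abs_hKer_sub_hlKer_le hj hw hc zero_lt_one hδ.le (fun μ ν x y => (hHB P rfl rfl j hj μ ν x y).1) hR b b₁
  · exact abs_grad_hKer_sub_hlKer_le hj hw hc zero_lt_one hδ.le (fun μ ν x y => (hHB P rfl rfl j hj μ ν x y).1)
      (fun μ ν x y => (hHB P rfl rfl j hj μ ν x y).2) hC0 hR (hC R₁ R₀ hR) x μ lam b₁

end

end Literature.MathematicalPhysics.QuantumFieldTheory.BalabanImbrieJaffe1984to88.BIJ88HkLoc257AllTori
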